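import Mathlib
import HarnessLib
import Summits.NavierStokesRegularity.NavierStokesRegularity.Theorems.LocalSineTubeDoorLocalPointZoomSlices
import Summits.NavierStokesRegularity.NavierStokesRegularity.Theorems.LocalVelCompTubeDoorLocalPointZoomVel
import Summits.NavierStokesRegularity.NavierStokesRegularity.Theorems.LocalSineTubeDoorLocalPointZoomDiag

/-!
# The door family's velocity zoom with DIAGONAL convergence on every slice: `(λⱼ/ν) u(T + λⱼ²s/ν, x₀ + λⱼ yⱼ) → v(s, y)`
# for EVERY sequence `yⱼ → y`

Cell ns-regularity-ideate, seat p6 (route-directed support for the door family of LADDER-NS N0; same frame, same proof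
skeleton as `…LocalVelCompTubeDoorLocalPointZoomVelSlices.localPointZoomVelSlices` (S10's crux K1′), with the pointwise
velocity upgrade `localZoomFrame_tendsto` at the slice `−1` of the `σ = √(−s)`-rescaled frame replaced by the DIAGONAL
upgrade `…LocalSineTubeDoorLocalPointZoomDiag.localZoomFrame_diag` (locally uniform space–time convergence (U0) + joint
continuity of the analytic profile)):

* `localPointZoomVelSlicesDiag` — at a point where a classical Leray–Hopf flow is LOCALLY Type I but not backward
  bounded, some zoom sequence `λⱼ → 0⁺` converges to a backward-singular profile `v` of the Type-I class, and for every
  `s < 0`, every `y` AND EVERY SEQUENCE `yⱼ → y`, `(λⱼ/ν) u(T + λⱼ² s/ν, x₀ + λⱼ yⱼ) → v(s, y)`.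

PURPOSE: symmetry inheritance under MOVING frames (a rotation about an axis not through `x₀` acts on the zoom chart as
`y ↦ yⱼ(θ) → y + θ' J x₀`: consumed by `…LocalVelCompTubeDoorAxisymOffAxis`), window data read along moving points.

WHAT THIS IS NOT: not a claim about Navier–Stokes regularity; a blow-up/compactness lemma for door routes
(bears_on LADDER-NS N0).
-/

noncomputable section

-- the summit and its single sub-problem share the name (CONVENTIONS §1), as in every Theorems file
set_option linter.dupNamespace false

namespace Summit.NavierStokesRegularity.NavierStokesRegularity.Theorems.LocalVelCompTubeDoorLocalPointZoomVelSlicesDiag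

open MeasureTheory Set Function Filter Topology TopologicalSpace Metric
open Literature.Analysis Literature.Analysis.FluidPDE Literature.Analysis.FluidPDE.SereginSverak2009
open Summit.NavierStokesRegularity.NavierStokesRegularity.Theorems
open Summit.NavierStokesRegularity.NavierStokesRegularity.Theorems.LocalSineTubeDoorLocalPointZoomFrame
open Summit.NavierStokesRegularity.NavierStokesRegularity.Theorems.LocalSineTubeDoorLocalPointZoomSlices
open Summit.NavierStokesRegularity.NavierStokesRegularity.Theorems.LocalVelCompTubeDoorLocalPointZoomVel
open Summit.NavierStokesRegularity.NavierStokesRegularity.Theorems.LocalSineTubeDoorLocalPointZoomDiag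
open scoped NNReal ENNReal

/-- **LOCAL POINT ZOOM LIMIT WITH DIAGONAL VELOCITY CONVERGENCE ON EVERY SLICE**: at a point where a classical
Leray–Hopf flow is LOCALLY Type I but not backward bounded, some zoom sequence `λⱼ → 0⁺` of unit-viscosity rescalings
converges to a Type-I-rate, continuous, Oseen-mild, divergence-free profile with backward-singular apex, the rescaled
velocities `(λⱼ/ν) u(T + λⱼ²s/ν, x₀ + λⱼyⱼ)` converging to `v(s,y)` for every `s < 0`, every `y` and EVERY sequence
`yⱼ → y`. -/
theorem localPointZoomVelSlicesDiag :
    ∀ (ν T : ℝ), 0 < ν → 0 < T → ∀ (u : ℝ → EuclideanSpace ℝ (Fin 3) → EuclideanSpace ℝ (Fin 3))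
      (p : ℝ → EuclideanSpace ℝ (Fin 3) → ℝ),
    Literature.Analysis.FluidPDE.IsClassicalNSSolutionOn (Set.Ico 0 T) ν 0 u p →
    Literature.Analysis.FluidPDE.IsLerayHopfOn T ν 0 (u 0) u →
    Literature.Analysis.FluidPDE.HasRapidSpatialDecay (u 0) →
    ∀ (x₀ : EuclideanSpace ℝ (Fin 3)) (ρ M : ℝ), 0 < ρ →
    (∀ t ∈ Set.Ico 0 T, T - ρ ^ 2 < t → ∀ x ∈ Metric.ball x₀ ρ, ‖u t x‖ * Real.sqrt (ν * (T - t)) ≤ M) →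
    ¬ Literature.Analysis.FluidPDE.IsBackwardBoundedAt u T x₀ →
    ∃ (C : ℝ) (v : ℝ → EuclideanSpace ℝ (Fin 3) → EuclideanSpace ℝ (Fin 3)) (lam : ℕ → ℝ),
      (∀ j, 0 < lam j) ∧ Filter.Tendsto lam Filter.atTop (nhds 0) ∧
      (Literature.Analysis.FluidPDE.HasTypeITimeDecay C v ∧
        ContinuousOn (Function.uncurry v) (Set.Iio (0 : ℝ) ×ˢ Set.univ) ∧
        (∀ s t : ℝ, s < t → t < 0 → ∀ x, v t x =
          Literature.Analysis.UnboundedOperators.heatExtension (v s) (t - s) x -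
            Literature.Analysis.FluidPDE.oseenDuhamel 1 s v v t x) ∧
        (∀ t < 0, Literature.Analysis.FluidPDE.VectorCalculus.IsDivFree (v t))) ∧
      Literature.Analysis.FluidPDE.IsBackwardSingularPoint v 0 ∧
      ∀ s < 0, ∀ (y : EuclideanSpace ℝ (Fin 3)) (yseq : ℕ → EuclideanSpace ℝ (Fin 3)),
        Filter.Tendsto yseq Filter.atTop (nhds y) →
        Filter.Tendsto (fun j => (lam j / ν) • u (T + lam j ^ 2 * s / ν) (x₀ + lam j • yseq j)) Filter.atTop
          (nhds (v s y)) := by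
  intro ν T hν hT u p hsol hLH _ x₀ ρ M hρ hM hnotbd
  obtain ⟨R, C₁, v', π', lam, w, v₁, Ks, r₁, hR, hlam, hlam0, hball1, hr₁, hr₁1, hKs, hL3, hae, hP,
    hsing₁, hpt⟩ := localTreeZoomFrame hν hT hsol hLH hρ hM hnotbd
  refine ⟨C₁, v₁, fun j => R * (lam j / 2), fun j => mul_pos hR (half_pos (hlam j)),
    by simpa using (hlam0.div_const 2).const_mul R, hP, hsing₁, fun s hs y yseq hyseq => ?_⟩
  -- ## the scaling factor `σ = √(−s)`
  have hns : 0 < -s := neg_pos.2 hs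
  set σ : ℝ := Real.sqrt (-s) with hσdef
  have hσ : 0 < σ := Real.sqrt_pos.2 hns
  have hσ2 : σ ^ 2 = -s := Real.sq_sqrt hns.le
  have hσne : σ ≠ 0 := hσ.ne'
  -- ## the rescaled frame
  set lam' : ℕ → ℝ := fun j => σ * lam j with hlam'def
  have hlam' : ∀ j, 0 < lam' j := fun j => mul_pos hσ (hlam j)
  have hlam0' : Tendsto lam' atTop (𝓝 0) := by
    show Tendsto (fun j => σ * lam j) atTop (𝓝 0)
    simpa using hlam0.const_mul σ
  set w' : ℝ → (EuclideanSpace ℝ (Fin 3)) → (EuclideanSpace ℝ (Fin 3)) := σ • stPull (σ ^ 2) σ (0 : ℝ) (0 : (EuclideanSpace ℝ (Fin 3))) w with hw'def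
  set v₁' : ℝ → (EuclideanSpace ℝ (Fin 3)) → (EuclideanSpace ℝ (Fin 3)) := σ • stPull (σ ^ 2) σ (0 : ℝ) (0 : (EuclideanSpace ℝ (Fin 3))) v₁ with hv₁'def
  have hZZ : ∀ j, (lam' j) • stPull ((lam' j) ^ 2) (lam' j) (0 : ℝ) (0 : (EuclideanSpace ℝ (Fin 3))) v' =
      σ • stPull (σ ^ 2) σ (0 : ℝ) (0 : (EuclideanSpace ℝ (Fin 3)))
        ((lam j) • stPull ((lam j) ^ 2) (lam j) (0 : ℝ) (0 : (EuclideanSpace ℝ (Fin 3))) v') := by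
    intro j
    simp only [hlam'def]
    rw [zoom_zoom]
  -- (pt') identification with the zooms of `u` at the scales `R σλⱼ/2`
  have hpt' : ∀ (j : ℕ) (s' : ℝ) (y' : (EuclideanSpace ℝ (Fin 3))),
      ((lam' j) • stPull ((lam' j) ^ 2) (lam' j) (0 : ℝ) (0 : (EuclideanSpace ℝ (Fin 3))) v') s' y' =
        ((R * (lam' j / 2)) / ν) • u (T + (R * (lam' j / 2)) ^ 2 * s' / ν) (x₀ + (R * (lam' j / 2)) • y') := by
    intro j s' y'
    have h := hpt j (σ ^ 2 * s') (σ • y')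
    simp only [smul_stPull_apply, zero_add] at h ⊢
    simp only [hlam'def]
    rw [show (σ * lam j) ^ 2 * s' = lam j ^ 2 * (σ ^ 2 * s') by ring,
      show (σ * lam j) • y' = lam j • σ • y' by rw [smul_smul, mul_comm],
      mul_smul, h, smul_smul, smul_smul,
      show σ * (R * (lam j / 2) / ν) = R * (σ * lam j / 2) / ν by ring,
      show T + (R * (lam j / 2)) ^ 2 * (σ ^ 2 * s') / ν = T + (R * (σ * lam j / 2)) ^ 2 * s' / ν by ring,
      show R * (lam j / 2) * σ = R * (σ * lam j / 2) by ring]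
  -- (L3') local `L³` convergence of the rescaled zooms to `w'`
  have hus : ∀ f g : ℝ → (EuclideanSpace ℝ (Fin 3)) → (EuclideanSpace ℝ (Fin 3)), uncurry (f - g) = uncurry f - uncurry g := fun f g => rfl
  have hL3' : ∀ a : ℝ, 0 < a → Tendsto (fun j => eLpNorm
      (uncurry ((lam' j) • stPull ((lam' j) ^ 2) (lam' j) (0 : ℝ) (0 : (EuclideanSpace ℝ (Fin 3))) v') - uncurry w') 3
      (volume.restrict (parabolicCylinder a (0 : ℝ × (EuclideanSpace ℝ (Fin 3)))))) atTop (𝓝 0) := by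
    intro a ha
    have hdiff : ∀ j, uncurry ((lam' j) • stPull ((lam' j) ^ 2) (lam' j) (0 : ℝ) (0 : (EuclideanSpace ℝ (Fin 3))) v') -
        uncurry w' = uncurry (σ • stPull (σ ^ 2) σ (0 : ℝ) (0 : (EuclideanSpace ℝ (Fin 3)))
          ((lam j) • stPull ((lam j) ^ 2) (lam j) (0 : ℝ) (0 : (EuclideanSpace ℝ (Fin 3))) v' - w)) := by
      intro j
      rw [hZZ j]
      funext z
      obtain ⟨s', y'⟩ := z
      simp only [hw'def, uncurry_apply_pair, Pi.sub_apply, smul_stPull_apply, smul_sub]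
    have hconst : (‖σ‖ₑ * (ENNReal.ofReal ((σ ^ 2 * σ ^ 3)⁻¹)) ^ (1 / (3 : ℝ≥0∞).toReal)) ≠ ⊤ :=
      ENNReal.mul_ne_top enorm_ne_top
        (ENNReal.rpow_ne_top_of_nonneg (one_div_nonneg.2 ENNReal.toReal_nonneg) ENNReal.ofReal_ne_top)
    have key := ENNReal.Tendsto.const_mul (hL3 (a * σ) (mul_pos ha hσ)) (Or.inr hconst)
    rw [mul_zero] at key
    refine key.congr fun j => ?_
    rw [hdiff j]
    conv_rhs => rw [show a = a * σ / σ by field_simp]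
    rw [eLpNorm_uncurry_zoom hσ σ _ (a * σ) three_ne_zero ENNReal.ofNat_ne_top, hus]
  -- (ae') the rescaled limit agrees a.e. with the rescaled profile
  have hslab : stAffine (σ ^ 2) σ (0 : ℝ) (0 : (EuclideanSpace ℝ (Fin 3))) ⁻¹' (Iio (0 : ℝ) ×ˢ (univ : Set (EuclideanSpace ℝ (Fin 3)))) =
      Iio (0 : ℝ) ×ˢ (univ : Set (EuclideanSpace ℝ (Fin 3))) := by
    ext z
    simp only [mem_preimage, mem_prod, mem_Iio, mem_univ, and_true, stAffine_fst, zero_add]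
    exact ⟨fun h => neg_of_mul_neg_right h (pow_pos hσ 2).le,
      fun h => mul_neg_of_pos_of_neg (pow_pos hσ 2) h⟩
  have hae' : ∀ᵐ x ∂(volume.restrict (Iio (0 : ℝ) ×ˢ (univ : Set (EuclideanSpace ℝ (Fin 3))))),
      uncurry w' x = uncurry v₁' x := by
    have h := ae_eq_restrict_comp_stAffine (f := uncurry w) (g := uncurry v₁) (pow_pos hσ 2) hσ
      (0 : ℝ) (0 : (EuclideanSpace ℝ (Fin 3))) hae
    rw [hslab] at h
    filter_upwards [h] with z hz
    show σ • uncurry w (stAffine (σ ^ 2) σ (0 : ℝ) (0 : (EuclideanSpace ℝ (Fin 3))) z) =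
      σ • uncurry v₁ (stAffine (σ ^ 2) σ (0 : ℝ) (0 : (EuclideanSpace ℝ (Fin 3))) z)
    rw [show uncurry w (stAffine (σ ^ 2) σ (0 : ℝ) (0 : (EuclideanSpace ℝ (Fin 3))) z) =
      uncurry v₁ (stAffine (σ ^ 2) σ (0 : ℝ) (0 : (EuclideanSpace ℝ (Fin 3))) z) from hz]
  -- (P') the rescaled profile is in the class (scaling invariance of rate / continuity / mildness)
  have hrate' : HasTypeITimeDecay C₁ v₁' := rate_smul_stPull hP.1 hσ
  have hcont' : ContinuousOn (uncurry v₁') (Iio (0 : ℝ) ×ˢ univ) := cont_smul_stPull hP.2.1 hσ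
  have hmild' := mild_smul_stPull hP.2.2.1 hσ  -- ## the velocity upgrade at time `−1` of the rescaled frame
  -- the moving points in the rescaled frame: `σ⁻¹ • yⱼ → σ⁻¹ • y`, at the constant slice `−1`
  have hyseq' : Tendsto (fun j => σ⁻¹ • yseq j) atTop (𝓝 (σ⁻¹ • y)) := hyseq.const_smul σ⁻¹
  have key := (localZoomFrame_diag hν hT hsol.smooth_velocity.continuousOn hρ hM hR hball1 hlam'
    hlam0' hr₁ hr₁1 hKs hpt' hL3' hae' hrate' hcont' hmild' (σ⁻¹ • y) tendsto_const_nhds hyseq').1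
  -- ## identification of the terms
  have hZ : ∀ j, ((lam' j) • stPull ((lam' j) ^ 2) (lam' j) (0 : ℝ) (0 : (EuclideanSpace ℝ (Fin 3))) v') (-1)
      (σ⁻¹ • yseq j) =
        σ • (((R * (lam j / 2)) / ν) • u (T + (R * (lam j / 2)) ^ 2 * s / ν) (x₀ + (R * (lam j / 2)) • yseq j)) := by
    intro j
    rw [hpt' j (-1) (σ⁻¹ • yseq j)]
    simp only [hlam'def, smul_smul]
    have e2 : T + (R * (σ * lam j / 2)) ^ 2 * (-1) / ν = T + (R * (lam j / 2)) ^ 2 * s / ν := by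
      have hs' : s = -σ ^ 2 := by rw [hσ2]; ring
      rw [hs']; ring
    have e3 : R * (σ * lam j / 2) * σ⁻¹ = R * (lam j / 2) := by
      calc R * (σ * lam j / 2) * σ⁻¹ = R * (lam j / 2) * (σ * σ⁻¹) := by ring
        _ = R * (lam j / 2) := by rw [mul_inv_cancel₀ hσne, mul_one]
    have e4 : R * (σ * lam j / 2) / ν = σ * (R * (lam j / 2) / ν) := by ring
    rw [e2, e3, e4]
  have hlimit : v₁' (-1) (σ⁻¹ • y) = σ • v₁ s y := by
    simp only [hv₁'def, smul_stPull_apply, smul_smul, mul_inv_cancel₀ hσne, one_smul, zero_add]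
    rw [show σ ^ 2 * (-1) = s by rw [hσ2]; ring]
  -- ## conclusion: divide by `σ`
  have key' : Tendsto (fun j => σ • (((R * (lam j / 2)) / ν) •
      u (T + (R * (lam j / 2)) ^ 2 * s / ν) (x₀ + (R * (lam j / 2)) • yseq j))) atTop (𝓝 (σ • v₁ s y)) := by
    rw [← hlimit]
    exact Tendsto.congr hZ key
  have key3 := key'.const_smul σ⁻¹
  simp only [smul_smul, inv_mul_cancel_left₀ hσne, inv_mul_cancel₀ hσne, one_smul] at key3
  exact key3

end Summit.NavierStokesRegularity.NavierStokesRegularity.Theorems.LocalVelCompTubeDoorLocalPointZoomVelSlicesDiag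

end
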